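import Mathlib

/-!
# Holomorphic root germs through simple roots (implicit function theorem)

This file proves the analytic input at the ROOT nodes of log-free term germs for the line
`generic-period-fibre` of the crux `RigidCore.SchanuelOnLogFreeCore`: if the coefficient functions
`aᵢ : ℂ → ℂ` (`i < d`) are complex-differentiable on the disc `Metric.ball ω r` and `w` is a SIMPLE
root of the monic polynomial `Y ^ d + Σ_{i<d} aᵢ(ω) Yⁱ`, i.e.

* `w ^ d + Σ aᵢ(ω) wⁱ = 0` and
* `d • w ^ (d-1) + Σ i • aᵢ(ω) w^{i-1} ≠ 0`,

then there is a function `g : ℂ → ℂ` with `g ω = w` which, on a smaller disc `Metric.ball ω r'`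
(`0 < r' ≤ r`), is complex-differentiable, satisfies the root identity
`g(z) ^ d + Σ aᵢ(z) g(z)ⁱ = 0` and stays a SIMPLE root there.

This is what makes the field of values of term germs relatively algebraically closed in `ℂ`.

## Proof

The holomorphic implicit function theorem, in the `ContDiffAt` form of Mathlib
(`Mathlib/Analysis/Calculus/ImplicitContDiff.lean`: `ContDiffAt.implicitFunction`,
`ContDiffAt.implicitFunction_apply_self`, `ContDiffAt.eventually_apply_implicitFunction`,
`ContDiffAt.contDiffAt_implicitFunction`), applied to the implicit equation
`F (z, Y) = Y ^ d + Σ aᵢ(z) Yⁱ` at `(ω, w)`: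

* `F` is `C¹` at `(ω, w)` because each `aᵢ`, being complex-differentiable on an open disc, is `C¹`
  there (`DifferentiableOn.contDiffOn`);
* the partial derivative `fderiv ℂ F (ω, w) ∘L inr` is the one-variable derivative of the
  polynomial map `Y ↦ F (ω, Y)` at `w`, namely multiplication by
  `c = d • w ^ (d-1) + Σ i • aᵢ(ω) w^{i-1} ≠ 0`, hence a continuous linear automorphism of `ℂ`
  (`HasDerivAt.hasFDerivAt_equiv`);
* the implicit function `g` then satisfies `g ω = w`, `F (z, g z) = F (ω, w) = 0` near `ω`, is `C¹`
  near `ω`, and by continuity the `∂_Y`-expression stays non-zero near `ω`; the three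
  neighbourhoods are intersected with the disc `Metric.ball ω r`.

Sources: holomorphic implicit function theorem (standard); Mathlib only.
-/

noncomputable section

namespace Summit.Schanuel.Schanuel.Theorems.RigidCore

open Filter Metric
open scoped Topology

/-- The derivative at `w` of the one-variable polynomial map `Y ↦ Y ^ d + Σ_{i<d} cᵢ Yⁱ` is
`d • w ^ (d-1) + Σ i • cᵢ • w^{i-1}`. -/
private theorem hasDerivAt_monicSum (d : ℕ) (c : Fin d → ℂ) (w : ℂ) :
    HasDerivAt (fun Y : ℂ => Y ^ d + ∑ i : Fin d, c i * Y ^ (i : ℕ))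
      ((d : ℂ) * w ^ (d - 1) + ∑ i : Fin d, ((i : ℕ) : ℂ) * c i * w ^ ((i : ℕ) - 1)) w := by
  refine (hasDerivAt_pow d w).add ?_
  have h : ∀ i ∈ (Finset.univ : Finset (Fin d)),
      HasDerivAt (fun Y : ℂ => c i * Y ^ (i : ℕ)) (((i : ℕ) : ℂ) * c i * w ^ ((i : ℕ) - 1)) w := by
    intro i _
    exact ((hasDerivAt_pow (i : ℕ) w).const_mul (c i)).congr_deriv (by ring)
  exact HasDerivAt.fun_sum h

/-- The implicit equation `F (z, Y) = Y ^ d + Σ aᵢ(z) Yⁱ` is `Cⁿ` at `(ω, w)` as soon as the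
coefficient functions `aᵢ` are `Cⁿ` at `ω`. -/
private theorem contDiffAt_monicSum {d : ℕ} {a : Fin d → ℂ → ℂ} {ω : ℂ} (w : ℂ)
    {n : WithTop ℕ∞} (ha : ∀ i, ContDiffAt ℂ n (a i) ω) :
    ContDiffAt ℂ n (fun p : ℂ × ℂ => p.2 ^ d + ∑ i : Fin d, a i p.1 * p.2 ^ (i : ℕ)) (ω, w) := by
  refine (contDiffAt_snd.pow d).add ?_
  exact ContDiffAt.sum fun i _ => (ha i).fst'.mul (contDiffAt_snd.pow _)

/-- The partial derivative in `Y` of the implicit equation `F (z, Y) = Y ^ d + Σ aᵢ(z) Yⁱ` at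
`(ω, w)` is multiplication by `c = d • w ^ (d-1) + Σ i • aᵢ(ω) w^{i-1}`; when `c ≠ 0` it is the
continuous linear automorphism `ContinuousLinearEquiv.unitsEquivAut ℂ c` of `ℂ`. -/
private theorem fderiv_monicSum_comp_inr {d : ℕ} {a : Fin d → ℂ → ℂ} {ω w : ℂ}
    (hF : DifferentiableAt ℂ
      (fun p : ℂ × ℂ => p.2 ^ d + ∑ i : Fin d, a i p.1 * p.2 ^ (i : ℕ)) (ω, w))
    (hc : (d : ℂ) * w ^ (d - 1) + ∑ i : Fin d, ((i : ℕ) : ℂ) * a i ω * w ^ ((i : ℕ) - 1) ≠ 0) :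
    fderiv ℂ (fun p : ℂ × ℂ => p.2 ^ d + ∑ i : Fin d, a i p.1 * p.2 ^ (i : ℕ)) (ω, w) ∘L
        ContinuousLinearMap.inr ℂ ℂ ℂ =
      (ContinuousLinearEquiv.unitsEquivAut ℂ (Units.mk0 _ hc) : ℂ →L[ℂ] ℂ) := by
  have h1 : HasFDerivAt (fun Y : ℂ => Y ^ d + ∑ i : Fin d, a i ω * Y ^ (i : ℕ))
      (fderiv ℂ (fun p : ℂ × ℂ => p.2 ^ d + ∑ i : Fin d, a i p.1 * p.2 ^ (i : ℕ)) (ω, w) ∘L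
        ContinuousLinearMap.inr ℂ ℂ ℂ) w :=
    hF.hasFDerivAt.comp w (hasFDerivAt_prodMk_right (𝕜 := ℂ) ω w)
  exact h1.unique ((hasDerivAt_monicSum d (fun i => a i ω) w).hasFDerivAt_equiv hc)

/-- **Holomorphic root germ through a simple root** (holomorphic implicit function theorem).
If the coefficient functions `aᵢ` are complex-differentiable on the disc `Metric.ball ω r` and `w`
is a SIMPLE root of the monic polynomial `Y ^ d + Σ_{i<d} aᵢ(ω) Yⁱ` (the `∂_Y`-value at `(ω, w)`
is non-zero), then there is a function `g` with `g ω = w` which, on a smaller disc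
`Metric.ball ω r'` (`0 < r' ≤ r`), is complex-differentiable, satisfies the root identity
`g(z) ^ d + Σ aᵢ(z) g(z)ⁱ = 0`, and stays a simple root of `Y ^ d + Σ aᵢ(z) Yⁱ`. -/
theorem stub_rootGerm :
    ∀ (d : ℕ) (a : Fin d → ℂ → ℂ) (ω w : ℂ) (r : ℝ), 0 < r →
      (∀ i, DifferentiableOn ℂ (a i) (Metric.ball ω r)) →
      w ^ d + ∑ i : Fin d, a i ω * w ^ (i : ℕ) = 0 →
      (d : ℂ) * w ^ (d - 1) + ∑ i : Fin d, ((i : ℕ) : ℂ) * a i ω * w ^ ((i : ℕ) - 1) ≠ 0 →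
        ∃ g : ℂ → ℂ, g ω = w ∧ ∃ r' : ℝ, 0 < r' ∧ r' ≤ r ∧
          DifferentiableOn ℂ g (Metric.ball ω r') ∧
          (∀ z ∈ Metric.ball ω r', g z ^ d + ∑ i : Fin d, a i z * g z ^ (i : ℕ) = 0) ∧
          (∀ z ∈ Metric.ball ω r',
            (d : ℂ) * g z ^ (d - 1) + ∑ i : Fin d, ((i : ℕ) : ℂ) * a i z * g z ^ ((i : ℕ) - 1) ≠ 0) := by
  intro d a ω w r hr ha hroot hsimple
  -- the coefficients are `C¹` at `ω` (complex-differentiable on an open disc)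
  have hball : Metric.ball ω r ∈ 𝓝 ω := Metric.ball_mem_nhds ω hr
  have ha_cd : ∀ i, ContDiffAt ℂ 1 (a i) ω := fun i =>
    ((ha i).contDiffOn Metric.isOpen_ball).contDiffAt hball
  -- the implicit equation is `C¹` at `(ω, w)` with invertible partial derivative in `Y`
  have cdf : ContDiffAt ℂ 1
      (fun p : ℂ × ℂ => p.2 ^ d + ∑ i : Fin d, a i p.1 * p.2 ^ (i : ℕ)) (ω, w) :=
    contDiffAt_monicSum w ha_cd
  have if₂ : (fderiv ℂ (fun p : ℂ × ℂ => p.2 ^ d + ∑ i : Fin d, a i p.1 * p.2 ^ (i : ℕ)) (ω, w) ∘L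
      ContinuousLinearMap.inr ℂ ℂ ℂ).IsInvertible := by
    rw [fderiv_monicSum_comp_inr (cdf.differentiableAt one_ne_zero) hsimple]
    exact ⟨_, rfl⟩
  -- the implicit function
  set g : ℂ → ℂ := cdf.implicitFunction one_ne_zero if₂ with hg
  have hgω : g ω = w := cdf.implicitFunction_apply_self one_ne_zero if₂
  have hgcd : ContDiffAt ℂ 1 g ω := cdf.contDiffAt_implicitFunction one_ne_zero if₂
  -- (1) the root identity holds near `ω`
  have h_root : ∀ᶠ z in 𝓝 ω, g z ^ d + ∑ i : Fin d, a i z * g z ^ (i : ℕ) = 0 := by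
    filter_upwards [cdf.eventually_apply_implicitFunction one_ne_zero if₂] with z hz
    exact hz.trans hroot
  -- (2) `g` is differentiable near `ω`
  have h_diff : ∀ᶠ z in 𝓝 ω, DifferentiableAt ℂ g z := by
    filter_upwards [hgcd.eventually (by simp)] with z hz
    exact hz.differentiableAt one_ne_zero
  -- (3) the root stays simple near `ω`
  have h_simple : ∀ᶠ z in 𝓝 ω,
      (d : ℂ) * g z ^ (d - 1) + ∑ i : Fin d, ((i : ℕ) : ℂ) * a i z * g z ^ ((i : ℕ) - 1) ≠ 0 := by
    have hc : ContDiffAt ℂ 1 (fun z => (d : ℂ) * g z ^ (d - 1) +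
        ∑ i : Fin d, ((i : ℕ) : ℂ) * a i z * g z ^ ((i : ℕ) - 1)) ω :=
      (contDiffAt_const.mul (hgcd.pow _)).add
        (ContDiffAt.sum fun i _ => (contDiffAt_const.mul (ha_cd i)).mul (hgcd.pow _))
    refine hc.continuousAt.eventually_ne ?_
    show (d : ℂ) * g ω ^ (d - 1) + ∑ i : Fin d, ((i : ℕ) : ℂ) * a i ω * g ω ^ ((i : ℕ) - 1) ≠ 0
    rw [hgω]
    exact hsimple
  -- intersect the three neighbourhoods with the disc
  obtain ⟨r₀, hr₀, hr₀ball⟩ :=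
    Metric.eventually_nhds_iff_ball.1 (h_root.and (h_diff.and h_simple))
  refine ⟨g, hgω, min r₀ r, lt_min hr₀ hr, min_le_right _ _, ?_, ?_, ?_⟩
  · exact fun z hz =>
      (hr₀ball z (Metric.ball_subset_ball (min_le_left _ _) hz)).2.1.differentiableWithinAt
  · exact fun z hz => (hr₀ball z (Metric.ball_subset_ball (min_le_left _ _) hz)).1
  · exact fun z hz => (hr₀ball z (Metric.ball_subset_ball (min_le_left _ _) hz)).2.2

end Summit.Schanuel.Schanuel.Theorems.RigidCore

end
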